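import Literature.NumberTheory.Sieve.MatomakiRadziwillProofs
import Summits.ValiantsHypothesis.ValiantsHypothesis.Theorems.LiouvilleSarnakAlignedTypeITransposed
import HarnessLib

/-!
# Route LiouvilleSarnak — `AlignedTypeI` (stmt-ValiantsHypothesis-21040): the transposed rung, unconditionally

One-line discharges of the conditional theorems of `LiouvilleSarnakAlignedTypeITransposed.lean` by the tree's proof
of Matomäki–Radziwiłł's Theorem 1 (`Literature.NumberTheory.Sieve.MatomakiRadziwill2016_theorem1_holds`, file
`Literature/NumberTheory/Sieve/MatomakiRadziwillProofs.lean`, proved from Vinogradov's mean value theorem upward).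
Kept in a separate file because that import is heavy.

* `sum_abs_blockSum_le` — for every `ε > 0` there is `h₀` with `Σ_{b<B} |Σ_{a<h} λ(a + hb + 1)| ≤ ε h B` for all
  `h ≥ h₀` and all `B` (Liouville has `o(h)` sum on all but `o(B)` blocks of length `h`, `ℓ¹` form).
* `sum_abs_dyadicBlockSum_le` — the case `h = 2^n`, any `B`.
* `alignedTypeI_transposed` — `∀ ε > 0, ∃ n₀, ∀ n ≥ n₀, Σ_{b<2^n} |Σ_{a<2^n} λ(a + 2^n b + 1)| ≤ ε · 4^n`:
  the statement `AlignedTypeI` with the two digit blocks exchanged (intervals of length `√x` instead of progressions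
  of modulus `√x`), UNCONDITIONAL.

HONEST FRAMING.  The interval side of the aligned cut is a theorem; the progression side (`AlignedTypeI` itself, closed
by hands g0–g2 only modulo `KMT2023_theorem13_liouville_twoPower`) is not advanced by this file; `VP ≠ VNP` is NOT
touched.
-/

set_option linter.dupNamespace false

noncomputable section

namespace Summit.ValiantsHypothesis.ValiantsHypothesis.Theorems.LiouvilleSarnak.AlignedTypeI.Transposed

open ArithmeticFunction Finset
open Literature.NumberTheory.Sieve

/-- **`ℓ¹` over blocks of length `h → ∞`, unconditionally**: for every `ε > 0` there is `h₀` such that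
`Σ_{b<B} |Σ_{a<h} λ(a + hb + 1)| ≤ ε h B` for all `h ≥ h₀` and all `B`.
[cite: MatomakiRadziwillAnnals2016, Theorem 1] -/
theorem sum_abs_blockSum_le {ε : ℝ} (hε : 0 < ε) :
    ∃ h₀ : ℕ, ∀ h : ℕ, h₀ ≤ h → ∀ B : ℕ,
      ∑ b ∈ range B, |∑ a ∈ range h, (liouville (a + h * b + 1) : ℝ)| ≤ ε * h * B :=
  sum_abs_blockSum_le_of_MR MatomakiRadziwill2016_theorem1_holds hε

/-- **Dyadic blocks, unconditionally**: for every `ε > 0` there is `n₀` such that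
`Σ_{b<B} |Σ_{a<2^n} λ(a + 2^n b + 1)| ≤ ε 2^n B` for all `n ≥ n₀` and all `B`.
[cite: MatomakiRadziwillAnnals2016, Theorem 1] -/
theorem sum_abs_dyadicBlockSum_le {ε : ℝ} (hε : 0 < ε) :
    ∃ n₀ : ℕ, ∀ n : ℕ, n₀ ≤ n → ∀ B : ℕ,
      ∑ b ∈ range B, |∑ a ∈ range (2 ^ n), (liouville (a + 2 ^ n * b + 1) : ℝ)| ≤ ε * 2 ^ n * B :=
  sum_abs_dyadicBlockSum_le_of_MR MatomakiRadziwill2016_theorem1_holds hε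

/-- **The TRANSPOSED rung of `AlignedTypeI`, unconditionally**:
`∀ ε > 0, ∃ n₀, ∀ n ≥ n₀, Σ_{b<2^n} |Σ_{a<2^n} λ(a + 2^n b + 1)| ≤ ε · 4^n` — `AlignedTypeI` with the roles of the
low digits `a` and the high digits `b` exchanged (the rank-one test `u ≡ 1, w = signs` of `DigitalBilinearLiouville`
on the aligned cut), from Matomäki–Radziwiłł's Theorem 1 and the prime number theorem for `λ`, both proved in the
tree. [cite: MatomakiRadziwillAnnals2016, Theorem 1] -/
theorem alignedTypeI_transposed :
    ∀ ε : ℝ, 0 < ε → ∃ n₀ : ℕ, ∀ n ≥ n₀,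
      ∑ b : Fin (2 ^ n), |∑ a : Fin (2 ^ n),
        ((ArithmeticFunction.liouville ((a : ℕ) + 2 ^ n * (b : ℕ) + 1) : ℤ) : ℝ)| ≤ ε * 4 ^ n :=
  alignedTypeI_transposed_of_MR MatomakiRadziwill2016_theorem1_holds

end Summit.ValiantsHypothesis.ValiantsHypothesis.Theorems.LiouvilleSarnak.AlignedTypeI.Transposed
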